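/- Copyright: the b2b-balaban cell (near-miss cell 7), T⁴-continuum fan-out; row NE7b CRUX team (2), seat
t4-ne7b-formalise-leaf-05 (gen 33) — IR-46-2's standing division «… leaf-05 toy-instantiates» applied to the OWNER's SPEC
D-48-1 «THE PREFIX TWIN» (custodian leaf-03 g27: FILE 1 p289955, FILE 2 p290621), part 7 of the sanity series
(`CLAIMS.log` l.33727).  Released under the licence of the surrounding project. -/
import Summits.QuantumFields.BalabanUV.T4Continuum.Support.HistoryRealiseCellsRunAssemblyWTVSSanityLWData
import Summits.QuantumFields.BalabanUV.T4Continuum.Support.HistoryRealiseCellsRunAssemblyWTVSSanityToyData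
import Summits.QuantumFields.BalabanUV.T4Continuum.Support.HistoryRealiseCellsRunAssemblyWTVSLW

/-!
# Sanity for the (α) assembly, part 7: `HistReadDataLW` HAS A KERNEL INHABITANT — ALL 120 FIELDS, NO DATUM HYPOTHESIS — ON
THE CELL's TOY DATUM AT THE WINDOW COUPLINGS `e^{−L^S∕2}`, AND FILE 2's `toL` ∕ END RUN BY NAME ON IT BEYOND THE TWO WINDOWS
(companion of `HistoryRealiseCellsRunAssemblyWTVSDataLW` ∕ `…AssemblyWTVSLW`; lineage `t4-ne7b-formalise-leaf-05` gen 33)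

Summits-side support leaf of the T⁴-continuum cell (rung (B)+1 on a FINITE torus only; NOT infinite volume, NOT the
mass gap, NOT Clay; NOT a proof of NE7b — NOT PRINTED, NOT PROVED).  [decided toy] one-liners over parts 2–6 and leaf-09∕
leaf-06's toy datum `toyData F G` (`HistoryRealiseCellsRunApexWitness`: constant coupling flow, zero site counts, small-field
mass `1`, Boltzmann initial density; **(B) FAILS there**, `not_endStatementBPrinted_toy`), the custodian's FILE 2
(`HistReadDataLW.toL`, `nonempty_countRoadWitnessT3bWTVSL_of_histReadingLW`), REUSED BY NAME; nothing printed asserted,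
no `def … : Prop` fact, no cite-tagged hypothesis, zero `sorry`.

§5 THE WINDOW COUPLINGS `gW L S ≡ e^{−L^S∕2}`: `log gW⁻² = L^S`, so (2.5) with exponent `1` picks EXACTLY the size `L^S`
(`isRj_toyData_gW`), the pinned cost is `≥ 1` for every `cΛ ≥ 0` (`one_le_lamVol_toyData`), (2.7) holds at `β′ = 0`
for every `β₀ ≥ 0` (`flow27_toyData`, constant flow), and the run lies in the coupling interval `]0, e^{−ℓ∕2}]` AS SOON AS `ℓ ≤ L^S`
(`inInterval_toyData_gW`) — the two windows of FILE 2 are met by taking `S` large (`exists_pow_windows`, `2 ≤ L`).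
§6 **`histReadDataLW_toyData`** (the NAMED term) ∕ **`nonempty_histReadDataLW_toyData`**: `HistReadDataLW (toyData F G) C₃ O₁
θᵥ 1 1 n hn (gW F.L S) [] cΛ Lr Φ β₀ 4 2 1 1 1 3 Isk Isk …` INHABITED for every `1 ≤ S`, `0 < θᵥ`, `0 ≤ cΛ`, `0 ≤ Lr`, `0 ≤ Φ`
— part 6's `histReadDataLW₄` with every displayed input DISCHARGED (part 3's `ZD_toyData_le`∕`ZD_toyData_succ` at
`g₀ := gW F.L S`, `budget_toyR`, `shell_toyR`).
§7 FILE 2 ON IT: for `S` beyond both windows (`ℓ⋆ ≤ L^S`, `ℓ⋆ᵥ ≤ L^S`) the custodian's `HistReadDataLW.toL` yields the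
GUARDED record `HistReadDataL` (`nonempty_histReadDataL_toyData_viaLW`) and FILE 2 §2 the GUARDED witness
(`nonempty_countRoadWitnessT3bWTVSL_toyData_viaLW`); hence UNCONDITIONALLY **`exists_histReadDataL_toyData_viaLW`** ∕
**`exists_countRoadWitnessT3bWTVSL_toyData_viaLW`**: SOME window run of the toy datum carries the L4 record ∕ the guarded
witness THROUGH THE PREFIX ROAD — `RoundingRoomF` (both runs) and the eight volume calibrations + `huV` DERIVED by FILE 2
from the coupling interval, not displayed (a fourth inhabitation road after parts 3∕4's direct ones).
FILE 2 §3's terminal theorem is NOT instantiable here: its binder `hB` is FALSE on `toyData`, and its `hRead` quantifies over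
EVERY loop string where the toy's NE7 socket (`budget_toyR`: source-free two-run ratio) has content only for `[]` — said, not
hidden.

HONEST.  A node test of a hypothesis SHAPE on a decided toy where (B) FAILS: NO instance of `ContinuumYM4Torus` is or could
be derived from it; «inhabitable» = «no field unsatisfiable as typed» (jointly, at toy letters — c2), not «readings
realised non-trivially»; with no live component every H3-side field is VACUOUS BY DESIGN; proves nothing of Bałaban's;
BY-NAME EFFECT ON THE WALL: NONE; NE7b NOT proved; spine 0∕9.  HONEST DEPENDENCY (cell): continuum YM on T⁴ ⇐ BetaPertH ∧
nine spine estimates (0/9 proved); BetaPertH ⇐ (D1) ∧ (D4) ∧ CAP+tail; G-an2-4 gates asym, D1 and NE2/3/4.  Unchanged here.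
-/

open Finset MeasureTheory
open Literature.MathematicalPhysics.QuantumFieldTheory.Balaban1983to89
open Literature.MathematicalPhysics.QuantumFieldTheory.Balaban1983to89.B16SProfile (DropCtl)
open T4PersistenceDictionary T4PersistentHistoryCount T4BankedInduction T4PrintedShapeBanking
open T4WeightBudget T4GlobalDenominator T4LiveClassFibration T4LiveStructureGas T4LiveGasToTerms T4RecordPriceSeam
open T4PartnerMultiplicity T4IndicatorShell T4MatchingAssembly T4MatchingClosure T4MatchingClosureSocket T4Continuum
open T4StabilitySocket T4BranchingRecordsGas T4TaggedShapeBanking T4CanonicalMenus T4RenewalChains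
open Summit.QuantumFields.BalabanUV.T4Continuum.HistoryFlow Summit.QuantumFields.BalabanUV.T4Continuum.HistoryGen
open Summit.QuantumFields.BalabanUV.T4Continuum.HistoryAdmissible
open Summit.QuantumFields.BalabanUV.T4Continuum.HistoryGenealogyExtraction
open Summit.QuantumFields.BalabanUV.T4Continuum.HistoryGenealogyRealise
open Summit.QuantumFields.BalabanUV.T4Continuum.HistoryGenealogyInstantiate
open Summit.QuantumFields.BalabanUV.T4Continuum.HistoryGenealogyPedigree
open Summit.QuantumFields.BalabanUV.T4Continuum.HistoryAssemblyPedigree Summit.QuantumFields.BalabanUV.T4Continuum.HistoryAssemblyTerms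
open Summit.QuantumFields.BalabanUV.T4Continuum.HistoryAssemblyMult Summit.QuantumFields.BalabanUV.T4Continuum.HistoryAssemblyMultKey
open Summit.QuantumFields.BalabanUV.T4Continuum.HistoryAssemblyRealiseRun Summit.QuantumFields.BalabanUV.T4Continuum.HistorySocketTH
open Summit.QuantumFields.BalabanUV.T4Continuum.HistoryRealiseDistinct
open Summit.QuantumFields.BalabanUV.T4Continuum.HistoryRealiseCellsRunApexT3bWTVS
open Summit.QuantumFields.BalabanUV.T4Continuum.B16HistoryIndexedRepr
open Summit.QuantumFields.BalabanUV.T4Continuum.B16HistoryIndexedTrunc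
open Summit.QuantumFields.BalabanUV.T4Continuum.HistoryBankingLE Summit.QuantumFields.BalabanUV.T4Continuum.HistoryBankingVolumePlug
open Summit.QuantumFields.BalabanUV.T4Continuum.HistoryConstants Summit.QuantumFields.BalabanUV.T4Continuum.HistoryBankingDiscountCharge
open Summit.QuantumFields.BalabanUV.T4Continuum.HistoryBankingCreditRead Summit.QuantumFields.BalabanUV.T4Continuum.HistoryBankingFibreRoom
open Summit.QuantumFields.BalabanUV.T4Continuum.HistoryPriceNodeSum Summit.QuantumFields.BalabanUV.T4Continuum.HistoryPriceKeys
open Summit.QuantumFields.BalabanUV.T4Continuum.HistoryRealiseCellsRunSupplyWTVS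
open Summit.QuantumFields.BalabanUV.T4Continuum.HistoryRealiseCellsRunSupplyKeysWTVS
open Summit.QuantumFields.BalabanUV.T4Continuum.HistoryRealiseCellsRunSupplyWTVSSanity
open Summit.QuantumFields.BalabanUV.T4Continuum.HistoryRealiseCellsRunSupplyKeysWTVSSanity
open Summit.QuantumFields.BalabanUV.T4Continuum.HistoryRealiseCellsRunAssemblyWTVSData
open Summit.QuantumFields.BalabanUV.T4Continuum.HistoryRealiseCellsRunAssemblyWTVS
open Summit.QuantumFields.BalabanUV.T4Continuum.HistoryRealiseCellsRunAssemblyWTVSDataL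
open Summit.QuantumFields.BalabanUV.T4Continuum.HistoryRealiseCellsRunAssemblyWTVSDataLW
open Summit.QuantumFields.BalabanUV.T4Continuum.HistoryRealiseCellsRunAssemblyWTVSL
open Summit.QuantumFields.BalabanUV.T4Continuum.HistoryRealiseCellsRunAssemblyWTVSLW
open Literature.MathematicalPhysics.QuantumFieldTheory.Balaban1983to89.T4FiniteEpsInhabited
open Missing AveragingRT T4Continuum T4StabilitySocket T4MatchingClosure T4IndicatorShell T4LiveClassFibration
open T4RenewalChains T4PersistenceDictionary T4BranchingRecordsGas T4PrintedShapeBanking T4TaggedShapeBanking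
open Summit.QuantumFields.BalabanUV.T4Continuum.HistoryRealiseCellsRunApexWitness
open Summit.QuantumFields.BalabanUV.T4Continuum.HistoryRealiseCellsRunApexT3bWTVSL
open Summit.QuantumFields.BalabanUV.T4Continuum.HistoryBankingSharpShares (ell sBsharp)
open Summit.QuantumFields.BalabanUV.T4Continuum.HistoryBankingRoundingUnrounded (sRunr ApFlat)
open Summit.QuantumFields.BalabanUV.T4Continuum.HistoryBankingRoundingSupply (ellStar)
open Summit.QuantumFields.BalabanUV.T4Continuum.HistoryBankingVolumeWindow (uvol lamVol jvol log_lamVol one_le_lamVol)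
open Summit.QuantumFields.BalabanUV.T4Continuum.HistoryBankingVolumeSupply (ellVol)

namespace Summit.QuantumFields.BalabanUV.T4Continuum.HistoryRealiseCellsRunAssemblyWTVSSanity

noncomputable section

open B16HistoryIndexedRepr.Sanity B16HistoryIndexedRepr.SanityInput HistoryConstants.Sanity

set_option synthInstance.maxSize 1024

/-! ## §5 The window couplings `e^{−L^S∕2}`: (2.5) picks the size `L^S`, the pin, (2.7), the coupling interval -/

/-- the window couplings `gW L S ≡ e^{−L^S∕2}` (constant bare sequence) [decided toy] -/
def gW (L S : ℕ) : ℕ → ℝ := fun _ => Real.exp (-((L : ℝ) ^ S / 2))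

/-- `log gW⁻² = L^S` [decided toy] -/
theorem log_gW_inv_sq (L S K : ℕ) : Real.log ((gW L S K) ^ 2)⁻¹ = (L : ℝ) ^ S := by
  have h : ((gW L S K) ^ 2)⁻¹ = Real.exp ((L : ℝ) ^ S) := by
    rw [gW, sq, ← Real.exp_add, ← Real.exp_neg]
    congr 1
    ring
  rw [h, Real.log_exp]

/-- the window couplings are positive [decided toy] -/
theorem gW_pos (L S K : ℕ) : 0 < gW L S K := Real.exp_pos _

section ToyData

variable (F : T4Family) (G : Type) [GaugeGroup G] [MeasurableSpace G] [HaarData G] [RegularGaugeGroup G]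

omit [GaugeGroup G] [MeasurableSpace G] [HaarData G] [RegularGaugeGroup G] in
/-- `2 ≤ L^S` for `1 ≤ S` (the toy reading's memory `Rm ≡ 2 ≤ R`) [decided toy] -/
theorem two_le_L_pow {S : ℕ} (hS : 1 ≤ S) : 2 ≤ F.L ^ S :=
  le_trans (two_le_L F) (by simpa using Nat.pow_le_pow_right (lt_of_lt_of_le (by norm_num) (two_le_L F)) hS)

/-- **(2.5) ON THE TOY DATUM AT THE WINDOW COUPLINGS**: along the constant flow `g ≡ e^{−L^S∕2}` the size with exponent `1`
is EXACTLY `L^S` (`log g⁻² = L^S`; a smaller power of `L ≥ 2` is smaller). [decided toy] -/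
theorem isRj_toyData_gW (S K s : ℕ) :
    B14.IsRj F.L 1 (((toyData F G).C ⟨K, F.m, gW F.L S K⟩).flow.g s) (F.L ^ S) := by
  rw [toy_flow_g]
  refine ⟨S, rfl, ?_, fun s' hs' => ?_⟩
  · rw [pow_one, log_gW_inv_sq]
    push_cast
    exact le_rfl
  · rw [pow_one, log_gW_inv_sq] at hs'
    have h : F.L ^ S ≤ F.L ^ s' := by exact_mod_cast hs'
    exact (Nat.pow_le_pow_iff_right (lt_of_lt_of_le (by norm_num) (two_le_L F))).1 h

/-- **THE PINNED COST IS AT LEAST ONE ON THE TOY DATUM** for every `cΛ ≥ 0` (`ℓ ≡ L^S ≥ 1`). [decided toy] -/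
theorem one_le_lamVol_toyData {cΛ : ℝ} (hcΛ : 0 ≤ cΛ) (S K t : ℕ) :
    1 ≤ lamVol cΛ ((toyData F G).C ⟨K, F.m, gW F.L S K⟩).flow.g K t := by
  refine one_le_lamVol hcΛ (fun j _ => ?_) t
  show 1 ≤ Real.log ((((toyData F G).C ⟨K, F.m, gW F.L S K⟩).flow.g j) ^ 2)⁻¹
  rw [toy_flow_g, log_gW_inv_sq]
  exact_mod_cast Nat.one_le_pow S F.L (lt_of_lt_of_le (by norm_num) (two_le_L F))

/-- **(2.7) ON THE TOY DATUM** at `β′ = 0`, power `1`, any `β₀ ≥ 0` (constant flow, `ℓ = L^S ≥ 0`). [decided toy] -/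
theorem flow27_toyData {β₀ : ℝ} (hβ₀ : 0 ≤ β₀) (S K : ℕ) :
    B14.FlowIneq27 ((toyData F G).C ⟨K, F.m, gW F.L S K⟩).flow.g 0 β₀ 1 K := by
  rw [show ((toyData F G).C ⟨K, F.m, gW F.L S K⟩).flow.g = fun _ => gW F.L S K from funext fun k => toy_flow_g F G _ k]
  exact flow27_const _ hβ₀ 1 K (by rw [log_gW_inv_sq]; positivity)

/-- **THE TOY RUN LIES IN THE COUPLING INTERVAL `]0, e^{−ℓ∕2}]` AS SOON AS `ℓ ≤ L^S`.** [decided toy] -/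
theorem inInterval_toyData_gW {S : ℕ} {ℓ : ℝ} (h : ℓ ≤ (F.L : ℝ) ^ S) (K : ℕ) :
    ((toyData F G).C ⟨K, F.m, gW F.L S K⟩).flow.InInterval (Real.exp (-(ℓ / 2))) K := fun k _ => by
  show 0 < gW F.L S K ∧ gW F.L S K ≤ Real.exp (-(ℓ / 2))
  exact ⟨gW_pos F.L S K, Real.exp_le_exp.2 (by linarith)⟩

omit [GaugeGroup G] [MeasurableSpace G] [HaarData G] [RegularGaugeGroup G] in
/-- **BOTH WINDOWS ARE MET BY SOME `S ≥ 1`** (`2 ≤ L`). [decided toy] -/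
theorem exists_pow_windows (a b : ℝ) : ∃ S : ℕ, 1 ≤ S ∧ a ≤ (F.L : ℝ) ^ S ∧ b ≤ (F.L : ℝ) ^ S := by
  have hL : (1 : ℝ) < F.L := by exact_mod_cast lt_of_lt_of_le (by norm_num) (two_le_L F)
  obtain ⟨na, ha⟩ := pow_unbounded_of_one_lt a hL
  obtain ⟨nb, hb⟩ := pow_unbounded_of_one_lt b hL
  refine ⟨max 1 (max na nb), le_max_left _ _, ?_, ?_⟩
  · exact ha.le.trans (pow_le_pow_right₀ hL.le (le_trans (le_max_left _ _) (le_max_right _ _)))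
  · exact hb.le.trans (pow_le_pow_right₀ hL.le (le_trans (le_max_right _ _) (le_max_right _ _)))

/-! ## §6 The prefix-twin record on the toy datum — no datum hypothesis -/

/-- **THE NAMED INHABITANT** (leaf-01 g35's take-or-leave C-ne7bleaf01g35-3 INFO, honoured for the twin: consumers need not
re-spell the term): `HistReadDataLW` on the toy datum × the no-region reading of size `L^S`, at the window couplings
`e^{−L^S∕2}` (`1 ≤ S`), empty string, exponent `1`, toy constants `C₃`∕`O₁`, census letters `(p₁, η, η′, κ, κ₂, κᵥ) =
(4, 2, 1, 1, 1, 3)`, for every `0 < θᵥ`, `0 ≤ cΛ`, `0 ≤ Lr`, `0 ≤ Φ`, `0 ≤ β₀` — part 6's `histReadDataLW₄` with every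
displayed input DISCHARGED by §5 and part 3 (`ZD_toyData_le`, `ZD_toyData_succ`, `smallFieldMass_toy`, `toy_numSites`,
`shell_toyR`, `budget_toyR`). [decided toy] -/
def histReadDataLW_toyData {S : ℕ} (hS : 1 ≤ S) {θv : ℝ} (hθv : 0 < θv) {cΛ Lr Φ : ℝ} (hcΛ : 0 ≤ cΛ) (hLr : 0 ≤ Lr)
    (hΦ : 0 ≤ Φ) {β₀ : ℝ} (hβ₀ : 0 ≤ β₀) (n : ℕ) (hn : 0 < n) :
    HistReadDataLW (toyData F G) C₃ O₁ θv 1 1 n hn (gW F.L S) ([] : List (ULoop F)) cΛ Lr Φ β₀ 4 2 1 1 1 3 Isk Isk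
      (fun _ => Unit) μ₀ (fun _ => GoodClass.top Unit) (fun _ => Unit) μ₀ (fun _ => GoodClass.top Unit) :=
  histReadDataLW₄ (toyData F G) (avgMeasurable_toyData F G) (C := C₃) (O := O₁) le_rfl (by norm_num [C₃])
    (by norm_num [C₃]) (by norm_num [C₃]) (by norm_num [C₃]) (by norm_num [O₁]) (by norm_num [O₁]) (by norm_num [O₁])
    (by norm_num [O₁]) hθv 1 n hn (gW F.L S) [] (two_le_L_pow F hS) hcΛ hLr hΦ hβ₀ identities_C₃.1 identities_C₃.2.1
    identities_C₃.2.2.1 identities_C₃.2.2.2.1 identities_C₃.2.2.2.2.1 (by norm_num) le_rfl le_rfl le_rfl (by norm_num)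
    (ZD_toyData_le F G (gW F.L S)) (fun K s _ => isRj_toyData_gW F G S K s)
    (fun K t => one_le_lamVol_toyData F G hcΛ S K t) (fun K => flow27_toyData F G hβ₀ S K) (c₀ := 1) (n₁ := 0) one_pos
    (fun K => (smallFieldMass_toy F G K _).symm.le) (fun K => (smallFieldMass_toy F G (K + 1) _).symm.le)
    (fun K => by simp) (fun K => by simp) (shell_toyR _)
    (budget_toyR (fun K t _ => ZD_pos (toyData F G) (avgMeasurable_toyData F G) (gW F.L S) _ K t) _
      (ZD_toyData_succ F G (gW F.L S)) _)
    summable_zero summable_zero summable_zero summable_zero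

/-- **`HistReadDataLW` IS INHABITED — ALL 120 FIELDS, NO DATUM HYPOTHESIS** — on the toy datum (every `1 ≤ S`, `0 < θᵥ`,
`0 ≤ cΛ`, `0 ≤ Lr`, `0 ≤ Φ`, `0 ≤ β₀`). [decided toy] -/
theorem nonempty_histReadDataLW_toyData {S : ℕ} (hS : 1 ≤ S) {θv : ℝ} (hθv : 0 < θv) {cΛ Lr Φ : ℝ} (hcΛ : 0 ≤ cΛ)
    (hLr : 0 ≤ Lr) (hΦ : 0 ≤ Φ) {β₀ : ℝ} (hβ₀ : 0 ≤ β₀) (n : ℕ) (hn : 0 < n) :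
    Nonempty (HistReadDataLW (toyData F G) C₃ O₁ θv 1 1 n hn (gW F.L S) ([] : List (ULoop F)) cΛ Lr Φ β₀ 4 2 1 1 1 3
      Isk Isk (fun _ => Unit) μ₀ (fun _ => GoodClass.top Unit) (fun _ => Unit) μ₀ (fun _ => GoodClass.top Unit)) :=
  ⟨histReadDataLW_toyData F G hS hθv hcΛ hLr hΦ hβ₀ n hn⟩

/-! ## §7 FILE 2 on it: the guarded record and witness THROUGH THE PREFIX ROAD, beyond the two windows -/

/-- **THE CUSTODIAN's `HistReadDataLW.toL` RUN BY NAME ON THE TOY**: for `S` beyond the rounding window `ℓ⋆` and the volume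
window `ℓ⋆ᵥ` of FILE 2, the GUARDED record `HistReadDataL` on the toy datum at the window couplings — `RoundingRoomF` (both
runs) and the eight volume calibrations + `huV` DERIVED from the coupling interval by FILE 2, not displayed. [decided toy] -/
theorem nonempty_histReadDataL_toyData_viaLW {S : ℕ} (hS : 1 ≤ S) {θv : ℝ} (hθv : 0 < θv) {cΛ Lr Φ : ℝ} (hcΛ : 0 ≤ cΛ)
    (hLr : 0 ≤ Lr) (hΦ : 0 ≤ Φ) {β₀ : ℝ} (hβ₀ : 0 ≤ β₀) (n : ℕ) (hn : 0 < n)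
    (hr : ellStar C₃ O₁ F.L (O₁.d + 3) 2 1 1 (ApFlat O₁.γ₀ O₁.A₁ O₁.M Lr O₁.d) Φ ≤ (F.L : ℝ) ^ S)
    (hv : ellVol C₃ 1 1 3 cΛ θv (1 + β₀) (jvol 1 (1 + β₀)) ≤ (F.L : ℝ) ^ S) :
    Nonempty (HistReadDataL (toyData F G) C₃ O₁ θv 1 1 n hn (gW F.L S) ([] : List (ULoop F)) Isk Isk (fun _ => Unit) μ₀
      (fun _ => GoodClass.top Unit) (fun _ => Unit) μ₀ (fun _ => GoodClass.top Unit)) :=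
  (nonempty_histReadDataLW_toyData F G hS hθv hcΛ hLr hΦ hβ₀ n hn).map fun Dd =>
    Dd.toL (inInterval_toyData_gW F G hr) (inInterval_toyData_gW F G hv)

/-- **FILE 2 §2 RUN BY NAME ON THE TOY**: the GUARDED witness `CountRoadWitnessT3bWTVSL` on the toy datum at the window
couplings, THROUGH THE PREFIX ROAD (`nonempty_countRoadWitnessT3bWTVSL_of_histReadingLW`), for `S` beyond both windows.
[decided toy] -/
theorem nonempty_countRoadWitnessT3bWTVSL_toyData_viaLW {S : ℕ} (hS : 1 ≤ S) {θv : ℝ} (hθv : 0 < θv) {cΛ Lr Φ : ℝ}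
    (hcΛ : 0 ≤ cΛ) (hLr : 0 ≤ Lr) (hΦ : 0 ≤ Φ) {β₀ : ℝ} (hβ₀ : 0 ≤ β₀) (n : ℕ) (hn : 0 < n)
    (hr : ellStar C₃ O₁ F.L (O₁.d + 3) 2 1 1 (ApFlat O₁.γ₀ O₁.A₁ O₁.M Lr O₁.d) Φ ≤ (F.L : ℝ) ^ S)
    (hv : ellVol C₃ 1 1 3 cΛ θv (1 + β₀) (jvol 1 (1 + β₀)) ≤ (F.L : ℝ) ^ S) :
    Nonempty (CountRoadWitnessT3bWTVSL (toyData F G) C₃ O₁ θv 1 1 n hn (gW F.L S) ([] : List (ULoop F)) (HIndex.Idx Isk)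
      (ℕ × Lab 1) (Lab 1)) :=
  (nonempty_histReadDataLW_toyData F G hS hθv hcΛ hLr hΦ hβ₀ n hn).elim fun Dd =>
    nonempty_countRoadWitnessT3bWTVSL_of_histReadingLW Dd (inInterval_toyData_gW F G hr) (inInterval_toyData_gW F G hv)

/-- **UNCONDITIONALLY: SOME WINDOW RUN OF THE TOY DATUM CARRIES THE GUARDED RECORD THROUGH THE PREFIX ROAD** (take `S` beyond
both windows, `exists_pow_windows`). [decided toy] -/
theorem exists_histReadDataL_toyData_viaLW {θv : ℝ} (hθv : 0 < θv) {cΛ Lr Φ : ℝ} (hcΛ : 0 ≤ cΛ) (hLr : 0 ≤ Lr)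
    (hΦ : 0 ≤ Φ) {β₀ : ℝ} (hβ₀ : 0 ≤ β₀) (n : ℕ) (hn : 0 < n) :
    ∃ S : ℕ, Nonempty (HistReadDataL (toyData F G) C₃ O₁ θv 1 1 n hn (gW F.L S) ([] : List (ULoop F)) Isk Isk
      (fun _ => Unit) μ₀ (fun _ => GoodClass.top Unit) (fun _ => Unit) μ₀ (fun _ => GoodClass.top Unit)) := by
  obtain ⟨S, hS, hr, hv⟩ := exists_pow_windows F
    (ellStar C₃ O₁ F.L (O₁.d + 3) 2 1 1 (ApFlat O₁.γ₀ O₁.A₁ O₁.M Lr O₁.d) Φ) (ellVol C₃ 1 1 3 cΛ θv (1 + β₀) (jvol 1 (1 + β₀)))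
  exact ⟨S, nonempty_histReadDataL_toyData_viaLW F G hS hθv hcΛ hLr hΦ hβ₀ n hn hr hv⟩

/-- **… AND THE GUARDED WITNESS THROUGH THE PREFIX ROAD, UNCONDITIONALLY** (FILE 2 §2 on some window run). [decided toy] -/
theorem exists_countRoadWitnessT3bWTVSL_toyData_viaLW {θv : ℝ} (hθv : 0 < θv) {cΛ Lr Φ : ℝ} (hcΛ : 0 ≤ cΛ) (hLr : 0 ≤ Lr)
    (hΦ : 0 ≤ Φ) {β₀ : ℝ} (hβ₀ : 0 ≤ β₀) (n : ℕ) (hn : 0 < n) :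
    ∃ S : ℕ, Nonempty (CountRoadWitnessT3bWTVSL (toyData F G) C₃ O₁ θv 1 1 n hn (gW F.L S) ([] : List (ULoop F))
      (HIndex.Idx Isk) (ℕ × Lab 1) (Lab 1)) := by
  obtain ⟨S, hS, hr, hv⟩ := exists_pow_windows F
    (ellStar C₃ O₁ F.L (O₁.d + 3) 2 1 1 (ApFlat O₁.γ₀ O₁.A₁ O₁.M Lr O₁.d) Φ) (ellVol C₃ 1 1 3 cΛ θv (1 + β₀) (jvol 1 (1 + β₀)))
  exact ⟨S, nonempty_countRoadWitnessT3bWTVSL_toyData_viaLW F G hS hθv hcΛ hLr hΦ hβ₀ n hn hr hv⟩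

/-- HONESTY CERTIFICATE (leaf-09's, re-read here): (B) FAILS on the toy datum, so FILE 2 §3's terminal theorem (binder `hB`)
has no instance on it. [decided toy] -/
example : ¬ B16.EndStatementBPrinted (toyData F G).C := not_endStatementBPrinted_toy F G

end ToyData

end

end Summit.QuantumFields.BalabanUV.T4Continuum.HistoryRealiseCellsRunAssemblyWTVSSanity
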